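import Summits.QuantumFields.QCD.Theses.WilsonMobilityGap
import Summits.QuantumFields.QCD.Theorems.PauliWegnerSeaFMClosureUnquenchedHopping
import Literature.MathematicalPhysics.QuantumLattice.WilsonPositivityDomain
import Literature.MathematicalPhysics.QuantumFieldTheory.QCDPhaseQuenchedPositivity

/-!
# Crux `MobilityGap` (stmt-QuantumFields-9150), negative side — clause (iii) LOWER is the content

Support file of the standing disprover (cdisprove seat, cycle 1) of crux `MobilityGap` of route
`WilsonMobilityGap` (`Summit.QuantumFields.QCD.Theses.WilsonMobilityGap.MobilityGap`).  No
refutation — the crux survives cycle 1; this is its load-bearing analysis, sorry-free: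

* `ClauseI` / `Upper` / `Lower` / `Sign` / `Clauses`: VERBATIM abbreviations of the four per-mass
  clauses and of the body of the crux at a given regularisation (`mobilityGap_iff` is `Iff.rfl`).
  Statement abbreviations for the analysis, not facts.
* `no_rate_sandwich`: real analysis — `c₀ e^{-(A n + p log(n+1))} ≤ C e^{-B n}` for all large `n`
  is impossible when `A < B`.
* `not_lower_of_frequently_heavy`, `eventually_window_of_lower`, `eventually_mcrit_lt_of_lower`,
  `mobilityGap_witness_window`: clause (iii) ALONE forces every realised bare mass of ANY witness
  into `|m_f(k) + 4| < 41/10` eventually (so `m_crit(k) < 1/10` eventually): in the convergent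
  hopping region the landed bound `ThickCollarFarStability.stub_hopping` decays at a lattice rate,
  which (iii) forbids.
* `MobilityGapWithoutLower`, `mobilityGapWithoutLower_holds`, `heavyReg_not_lower`: the crux with
  (iii) deleted holds OUTRIGHT by the lattice-heavy regularisation `heavyReg` (`canonicalAF` with
  `m_crit ≡ 1`): (ii) by the hopping bound at any physical rate, (iv) with ratio `= 1` by Seiler
  positivity (`fermionDet_wilsonDirac_re_pos`); the same `heavyReg` violates (iii).
  Moral for provers: (i), (ii), (iv) and both scalings are jointly content-free; everything enters
  through (iii) — through proving that the decay of (ii) happens at LIGHT bare masses. [folklore]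
-/

noncomputable section

namespace Summit.QuantumFields.QCD.Theorems.MobilityGapNegative

open scoped BigOperators Topology
open MeasureTheory Filter Set
open Literature.MathematicalPhysics.QuantumFieldTheory Literature.MathematicalPhysics.QuantumLattice
  Literature.Probability.LatticeModels

/-! ### §0 The crux, clause by clause (definitional re-reading)

Reading notes (refuter's probe, rc 0):
* `m : Fin Nf → ℝ`, `0 < m f` componentwise; ONE `reg` serves all `m` (mass-independent scheme).
* bare trajectory `m_f(k) = reg.mcrit k + reg.a k * m f / reg.Zm k` (real division; `Zm k > 0` is a
  field of `QCDRegularisation`, so no `x/0` junk).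
* `‖v‖` for `v : Site 4 = Fin 4 → ℤ` is the sup norm of the integer absolute values
  (`Pi.norm_single`, `Int.norm_natCast`: `‖n e₀‖ = n`, `norm_single_natCast`), i.e. exactly `‖v‖∞`;
  `box 4 S = {-S,…,S}⁴` (`mem_box`), and on the torus of side `2S+1` the sup-torus-distance of
  `0` and `proj v` is `‖v‖∞` — consistent.
* every quotient `∫ |det| φ / ∫ |det|` has a POSITIVE denominator at every `β`, `S ≥ 0`, `mq`
  (`integral_norm_det_diracMatrix_pos_all`), so no `x/0 = 0` junk anywhere in (ii)–(iv); the
  integrands `|det| (Σ|G|)^s` are bounded (`|det|·|G| = |adj|`-type domination, tree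
  `norm_det_diracMatrix_mul_apply_inv_eq`) and `G = D⁻¹ := 0` at singular `D` carries weight
  `|det| = 0`.
* `(Σ|G|)^s` is `Real.rpow` with base `≥ 0`; `s ∈ (0,1)` strict.
* quantifier order: `∃ reg` BEFORE `∀ m`; inside, (ii) `∃ s δ C` before `∀ᶠ k ∀ S ≥ L_k`, (iii)
  `∃ s c₀ C₁ p` likewise (the two `s` are independent), (iv) only at side `2 L_k + 1`.
* nothing is vacuous: `QCDRegularisation Nf` with both scalings is inhabited (`canonicalAF`), and
  the hypotheses `Nf = 2 ∨ Nf = 3`, `0 < m f` are satisfiable.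
-/

variable {Nf : ℕ}

/-- The realised bare-mass tuple at step `k`. -/
abbrev bare (reg : QCDRegularisation Nf) (m : Fin Nf → ℝ) (k : ℕ) : Fin Nf → ℝ :=
  fun fl => reg.mcrit k + reg.a k * m fl / reg.Zm k

/-- The phase-quenched fractional moment of the flavour-`f` propagator block from `0` to `v` on the
torus of side `2S+1` — VERBATIM the functional of clauses (ii)/(iii) (and of the lead's `fm`). -/
def fm (Nf : ℕ) (β : ℝ) (mq : Fin Nf → ℝ) (S : ℕ) (f : Fin Nf) (v : Site 4) (s : ℝ) : ℝ :=
  (∫ U : GaugeConfig 4 (2 * S + 1) (Matrix.specialUnitaryGroup (Fin 3) ℂ),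
      ‖(diracMatrix U mq).det‖ *
        (∑ a : Fin 3, ∑ i : Fin 4, ∑ b : Fin 3, ∑ j : Fin 4,
          ‖(diracMatrix U mq)⁻¹ (quarkEquiv (f, (Torus.proj (2 * S + 1) 0, a, i)))
            (quarkEquiv (f, (Torus.proj (2 * S + 1) v, b, j)))‖) ^ s
      ∂(wilsonMeasure (fundamentalRep (Fin 3)) β)) /
    (∫ U : GaugeConfig 4 (2 * S + 1) (Matrix.specialUnitaryGroup (Fin 3) ℂ),
      ‖(diracMatrix U mq).det‖ ∂(wilsonMeasure (fundamentalRep (Fin 3)) β))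

/-- Clause (i): the bare masses stay on the physical branch `> -1` eventually. -/
def ClauseI (reg : QCDRegularisation Nf) (m : Fin Nf → ℝ) : Prop :=
  ∀ f : Fin Nf, ∀ᶠ k in atTop, -1 < reg.mcrit k + reg.a k * m f / reg.Zm k

/-- Clause (ii) UPPER: phase-quenched fractional-moment decay at a PHYSICAL rate `δ a_k`. -/
def Upper (reg : QCDRegularisation Nf) (m : Fin Nf → ℝ) : Prop :=
  ∃ s δ C : ℝ, 0 < s ∧ s < 1 ∧ 0 < δ ∧ ∀ᶠ k in atTop, ∀ S : ℕ, reg.L k ≤ S →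
    ∀ (f : Fin Nf) (v : Site 4), v ∈ box 4 S →
      fm Nf (reg.β k) (bare reg m k) S f v s ≤ C * Real.exp (-(δ * (reg.a k * ‖v‖)))

/-- Clause (iii) LOWER: the same moments are not lattice-small along the time axis. -/
def Lower (reg : QCDRegularisation Nf) (m : Fin Nf → ℝ) : Prop :=
  ∃ s c₀ C₁ p : ℝ, 0 < s ∧ s < 1 ∧ 0 < c₀ ∧ ∀ᶠ k in atTop, ∀ S : ℕ, reg.L k ≤ S →
    ∀ (f : Fin Nf) (n : ℕ), n ≤ S →
      c₀ * Real.exp (-(C₁ * (reg.a k * n) + p * Real.log (n + 1))) ≤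
        fm Nf (reg.β k) (bare reg m k) S f (Pi.single 0 (n : ℤ)) s

/-- Clause (iv) SIGN: sign coherence `|∫ det| / ∫ |det| ≥ 1/2` at the scheme's own side `2L_k+1`. -/
def Sign (reg : QCDRegularisation Nf) (m : Fin Nf → ℝ) : Prop :=
  ∀ᶠ k in atTop, (1 / 2 : ℝ) ≤
    ‖∫ U : GaugeConfig 4 (2 * reg.L k + 1) (Matrix.specialUnitaryGroup (Fin 3) ℂ), (diracMatrix U (bare reg m k)).det
        ∂(wilsonMeasure (fundamentalRep (Fin 3)) (reg.β k))‖ /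
      (∫ U : GaugeConfig 4 (2 * reg.L k + 1) (Matrix.specialUnitaryGroup (Fin 3) ℂ), ‖(diracMatrix U (bare reg m k)).det‖
        ∂(wilsonMeasure (fundamentalRep (Fin 3)) (reg.β k)))

/-- The full clause package of one regularisation (both scalings + (i)–(iv) for all `m > 0`). -/
def Clauses (Nf : ℕ) (reg : QCDRegularisation Nf) : Prop :=
  reg.HasMassScaling ∧ (reg.scheme 0 0 0).HasAsymptoticScaling ∧
    ∀ m : Fin Nf → ℝ, (∀ f, 0 < m f) → ClauseI reg m ∧ Upper reg m ∧ Lower reg m ∧ Sign reg m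

/-- The crux, re-read (definitional). -/
theorem mobilityGap_iff :
    Summit.QuantumFields.QCD.Theses.WilsonMobilityGap.MobilityGap ↔
      ∀ Nf : ℕ, Nf = 2 ∨ Nf = 3 → ∃ reg : QCDRegularisation Nf, Clauses Nf reg :=
  Iff.rfl

/-! ### §1 Pure analysis: no two-sided rate sandwich -/

/-- **No rate sandwich.** If `A < B` and `c₀ > 0`, the bounds
`c₀ e^{-(A n + p log (n+1))} ≤ C e^{-B n}` cannot hold for all large `n`
(the ratio is `(C/c₀) e^{B-A} (n+1)^p e^{-(B-A)(n+1)} → 0`).  This is the analytic core of every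
"(iii) versus a faster upper bound" contradiction below. -/
theorem no_rate_sandwich {c₀ C A B p : ℝ} (hc₀ : 0 < c₀) (hAB : A < B) (N₀ : ℕ)
    (h : ∀ n : ℕ, N₀ ≤ n →
      c₀ * Real.exp (-(A * n + p * Real.log (n + 1))) ≤ C * Real.exp (-(B * n))) : False := by
  -- Step 1: rewrite each instance as `c₀ ≤ C e^{B-A} · ((n+1)^p e^{-(B-A)(n+1)})`.
  have key : ∀ n : ℕ, N₀ ≤ n →
      c₀ ≤ C * Real.exp (B - A) * ((((n : ℝ) + 1) ^ p) * Real.exp (-(B - A) * ((n : ℝ) + 1))) := by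
    intro n hn
    have hn1 : (0 : ℝ) < n + 1 := by positivity
    have h1 := h n hn
    have hpos : 0 < Real.exp (A * n) * ((n : ℝ) + 1) ^ p := by positivity
    have e1 : Real.exp (-(A * n + p * Real.log (n + 1))) * (Real.exp (A * n) * ((n : ℝ) + 1) ^ p) = 1 := by
      rw [Real.rpow_def_of_pos hn1, ← Real.exp_add, ← Real.exp_add, ← Real.exp_zero]
      congr 1; ring
    have e2 : C * Real.exp (-(B * n)) * (Real.exp (A * n) * ((n : ℝ) + 1) ^ p) =
        C * Real.exp (B - A) * ((((n : ℝ) + 1) ^ p) * Real.exp (-(B - A) * ((n : ℝ) + 1))) := by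
      have : Real.exp (-(B * n)) * Real.exp (A * n) = Real.exp (B - A) * Real.exp (-(B - A) * ((n : ℝ) + 1)) := by
        rw [← Real.exp_add, ← Real.exp_add]; congr 1; ring
      calc C * Real.exp (-(B * n)) * (Real.exp (A * n) * ((n : ℝ) + 1) ^ p)
          = C * ((n : ℝ) + 1) ^ p * (Real.exp (-(B * n)) * Real.exp (A * n)) := by ring
        _ = C * ((n : ℝ) + 1) ^ p * (Real.exp (B - A) * Real.exp (-(B - A) * ((n : ℝ) + 1))) := by rw [this]
        _ = _ := by ring
    have h2 := mul_le_mul_of_nonneg_right h1 hpos.le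
    rw [mul_assoc c₀, e1, mul_one, e2] at h2
    exact h2
  -- Step 2: the right-hand side tends to `0`.
  have hlim : Tendsto (fun n : ℕ => C * Real.exp (B - A) *
      ((((n : ℝ) + 1) ^ p) * Real.exp (-(B - A) * ((n : ℝ) + 1)))) atTop (𝓝 (C * Real.exp (B - A) * 0)) := by
    refine tendsto_const_nhds.mul ?_
    have h0 := tendsto_rpow_mul_exp_neg_mul_atTop_nhds_zero p (B - A) (by linarith)
    have h1 : Tendsto (fun n : ℕ => (n : ℝ) + 1) atTop atTop :=
      tendsto_atTop_add_const_right _ 1 tendsto_natCast_atTop_atTop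
    exact h0.comp h1
  rw [mul_zero] at hlim
  obtain ⟨n, hlt, hn⟩ := ((hlim.eventually (eventually_lt_nhds hc₀)).and (eventually_ge_atTop N₀)).exists
  exact absurd (key n hn) (not_le.2 hlt)

/-! ### §2 Load-bearing analysis of clause (iii): LOWER pins the bare masses -/

/-- `n e₀ ∈ box 4 n`. -/
theorem single_mem_box (n : ℕ) : (Pi.single 0 (n : ℤ) : Site 4) ∈ box 4 n := by
  rw [mem_box]
  intro i
  by_cases hi : i = 0
  · subst hi; simp
  · simp [Pi.single_eq_of_ne hi]

/-- `‖n e₀‖∞ = n`. -/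
theorem norm_single_natCast (n : ℕ) : ‖(Pi.single 0 (n : ℤ) : Site 4)‖ = n := by
  rw [Pi.norm_single, Int.norm_natCast]

/-- **(iii) is false on every trajectory that is frequently in the convergent hopping region.**
If for some flavour `f` the realised bare mass satisfies `|m_f(k) + 4| ≥ 41/10` for infinitely many
`k` (lattice-heavy `m_f(k) ≥ 1/10`, or doubler-side `m_f(k) ≤ -81/10`), then clause (iii) LOWER
fails: at such `k` the landed hopping bound (`ThickCollarFarStability.stub_hopping`) gives the
LATTICE-rate upper bound `fm ≤ 1440 e^{-log(41/40) s n}` on every torus, while (iii) demands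
`fm ≥ c₀ e^{-C₁ a_k n}(n+1)^{-p}` with `C₁ a_k → 0`; `no_rate_sandwich` at a `k` with
`C₁ a_k ≤ log(41/40) s / 2`.  ("Any proof must keep the bare masses light; the lattice-heavy escape
from (ii)+(iv) is closed by (iii) alone.") -/
theorem not_lower_of_frequently_heavy (reg : QCDRegularisation Nf) (m : Fin Nf → ℝ) (f : Fin Nf)
    (hheavy : ∃ᶠ k in atTop, (41 / 10 : ℝ) ≤ |reg.mcrit k + reg.a k * m f / reg.Zm k + 4|) :
    ¬ Lower reg m := by
  rintro ⟨s, c₀, C₁, p, hs, hs1, hc₀, hL⟩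
  obtain ⟨C, μ, -, hμ, hhop⟩ := Summit.QuantumFields.QCD.Theorems.ThickCollarFarStability.stub_hopping Nf
  have hμs : 0 < μ * s := mul_pos hμ hs
  have hsmall : ∀ᶠ k in atTop, C₁ * reg.a k ≤ μ * s / 2 := by
    have ht : Tendsto (fun k => C₁ * reg.a k) atTop (𝓝 (C₁ * 0)) := reg.tendsto_a.const_mul C₁
    rw [mul_zero] at ht
    exact ht.eventually (eventually_le_nhds (by positivity))
  obtain ⟨k, ⟨hLk, hsk⟩, hhk⟩ := ((hL.and hsmall).and_frequently hheavy).exists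
  refine no_rate_sandwich (A := C₁ * reg.a k) (B := μ * s) (C := C) (p := p) hc₀ (by linarith)
    (reg.L k) fun n hn => ?_
  have h1 := hLk n hn f n le_rfl
  have h2 : fm Nf (reg.β k) (bare reg m k) n f (Pi.single 0 (n : ℤ)) s ≤
      C * Real.exp (-(μ * s * ‖(Pi.single 0 (n : ℤ) : Site 4)‖)) :=
    hhop (reg.β k) (bare reg m k) f hhk n s hs hs1 _ (single_mem_box n)
  rw [norm_single_natCast] at h2
  have e : C₁ * reg.a k * (n : ℝ) = C₁ * (reg.a k * n) := mul_assoc _ _ _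
  rw [e]
  exact h1.trans h2

/-- **LOWER ⇒ bare-mass window.** Along any regularisation and mass tuple for which clause (iii)
holds, every realised bare mass is eventually in the open window `(-81/10, 1/10)`:
`|m_f(k) + 4| < 41/10`.  In particular `m_crit(k) < 1/10` eventually (the increments
`a_k m_f / Z_m(k)` are positive), i.e. the flavour-blind critical mass of ANY witness of the crux is
supercritical-or-light, never lattice-heavy. -/
theorem eventually_window_of_lower (reg : QCDRegularisation Nf) (m : Fin Nf → ℝ)
    (h : Lower reg m) (f : Fin Nf) :
    ∀ᶠ k in atTop, |reg.mcrit k + reg.a k * m f / reg.Zm k + 4| < 41 / 10 := by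
  by_contra hne
  rw [not_eventually] at hne
  exact not_lower_of_frequently_heavy reg m f (hne.mono fun k hk => not_lt.1 hk) h

/-- The critical mass of a witness is eventually `< 1/10` (for `N_f ≥ 1` and any positive tuple). -/
theorem eventually_mcrit_lt_of_lower (reg : QCDRegularisation Nf) (m : Fin Nf → ℝ)
    (hm : ∀ f, 0 < m f) (h : Lower reg m) (f : Fin Nf) :
    ∀ᶠ k in atTop, reg.mcrit k < 1 / 10 := by
  filter_upwards [eventually_window_of_lower reg m h f] with k hk
  have hpos : 0 < reg.a k * m f / reg.Zm k := div_pos (mul_pos (reg.a_pos k) (hm f)) (reg.Zm_pos k)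
  have := (abs_lt.1 hk).2
  linarith

/-- **Crux-level corollary.** Every witness of `MobilityGap` realises, for every positive mass tuple,
bare trajectories eventually inside `|m_f(k) + 4| < 41/10`, with `m_crit(k) < 1/10` eventually. -/
theorem mobilityGap_witness_window
    (h : Summit.QuantumFields.QCD.Theses.WilsonMobilityGap.MobilityGap) :
    ∀ Nf : ℕ, Nf = 2 ∨ Nf = 3 → ∃ reg : QCDRegularisation Nf, Clauses Nf reg ∧
      ∀ m : Fin Nf → ℝ, (∀ f, 0 < m f) → ∀ f : Fin Nf,
        (∀ᶠ k in atTop, |reg.mcrit k + reg.a k * m f / reg.Zm k + 4| < 41 / 10) ∧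
        (∀ᶠ k in atTop, reg.mcrit k < 1 / 10) := by
  intro Nf hNf
  obtain ⟨reg, hreg⟩ := mobilityGap_iff.1 h Nf hNf
  exact ⟨reg, hreg, fun m hm f =>
    ⟨eventually_window_of_lower reg m (hreg.2.2 m hm).2.2.1 f,
     eventually_mcrit_lt_of_lower reg m hm (hreg.2.2 m hm).2.2.1 f⟩⟩

/-! ### §3 The crux WITHOUT clause (iii) is provable today (lattice-heavy witness)

`MobilityGapWithoutLower` = the crux text with the conjunct (iii) LOWER deleted.  It is INHABITED by
the lattice-heavy regularisation `heavyReg` (`canonicalAF` with `m_crit ≡ 1`): both scalings are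
identities of `canonicalAF`; (i) is `1 + (positive) > -1`; (ii) is the landed hopping bound at the
lattice rate `log(41/40)/2`, which dominates any physical rate `δ a_k` once `a_k ≤ log(41/40)/(2δ)`;
(iv) holds with ratio exactly `1`, because for POSITIVE bare masses every Wilson determinant is a
positive real (Seiler's positivity domain `κ < 1/8`, tree `fermionDet_wilsonDirac_re_pos`), so
`∫ det = ∫ |det| > 0`.  Together with §2 this localises the entire content of the crux in the
conjunction "(iii) ∧ the rest": the disprover cannot kill it by junk witnesses, and a prover cannot
inhabit it by them.
-/

/-- The crux with clause (iii) LOWER deleted (otherwise verbatim). -/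
def MobilityGapWithoutLower : Prop :=
  ∀ Nf : ℕ, Nf = 2 ∨ Nf = 3 → ∃ reg : QCDRegularisation Nf,
    reg.HasMassScaling ∧ (reg.scheme 0 0 0).HasAsymptoticScaling ∧
      ∀ m : Fin Nf → ℝ, (∀ f, 0 < m f) → ClauseI reg m ∧ Upper reg m ∧ Sign reg m

variable (Nf) in
/-- The LATTICE-HEAVY regularisation: `canonicalAF` (`a_k = 1/(k+1)`, `β_k = afBeta N_f 1 a_k`,
`L_k = (k+1)²`, canonical `Z_m`) with the critical mass parked at `m_crit ≡ 1` (hopping region). -/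
def heavyReg : QCDRegularisation Nf :=
  { QCDRegularisation.canonicalAF Nf with mcrit := fun _ => 1 }

/-- The critical mass of `heavyReg` is the constant `1`. [folklore] -/
@[simp] theorem heavyReg_mcrit (k : ℕ) : (heavyReg Nf).mcrit k = 1 := rfl

/-- `heavyReg` has leading-log mass scaling (it shares `Z_m`, `a` with `canonicalAF`). [folklore] -/
theorem heavyReg_hasMassScaling : (heavyReg Nf).HasMassScaling :=
  QCDRegularisation.canonicalAF_hasMassScaling

/-- `heavyReg` scales asymptotically (`β_k = afBeta N_f 1 a_k` by construction). [folklore] -/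
theorem heavyReg_hasAsymptoticScaling : ((heavyReg Nf).scheme 0 0 0).HasAsymptoticScaling := by
  refine ⟨1, one_pos, tendsto_const_nhds.congr' (Eventually.of_forall fun k => ?_)⟩
  show (0 : ℝ) = afBeta Nf 1 ((SpeciesScheme.zero Unit).a k) - afBeta Nf 1 ((SpeciesScheme.zero Unit).a k)
  rw [sub_self]

/-- The realised bare masses of `heavyReg` are `≥ 1`, hence in the hopping window `|m + 4| ≥ 41/10`. -/
theorem heavyReg_bare_window (m : Fin Nf → ℝ) (hm : ∀ f, 0 < m f) (k : ℕ) (f : Fin Nf) :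
    1 < bare (heavyReg Nf) m k f ∧ (41 / 10 : ℝ) ≤ |bare (heavyReg Nf) m k f + 4| := by
  have hpos : 0 < (heavyReg Nf).a k * m f / (heavyReg Nf).Zm k :=
    div_pos (mul_pos ((heavyReg Nf).a_pos k) (hm f)) ((heavyReg Nf).Zm_pos k)
  have h1 : 1 < bare (heavyReg Nf) m k f := by
    show 1 < (1 : ℝ) + (heavyReg Nf).a k * m f / (heavyReg Nf).Zm k
    linarith
  refine ⟨h1, ?_⟩
  rw [abs_of_pos (by linarith)]
  linarith

/-- For an all-POSITIVE bare tuple the multi-flavour Wilson determinant is the positive real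
`|det|` at EVERY gauge field (Seiler positivity, flavour by flavour). -/
theorem det_diracMatrix_eq_norm_of_pos {S : ℕ} [NeZero S] (U : GaugeConfig 4 S (Matrix.specialUnitaryGroup (Fin 3) ℂ))
    (mq : Fin Nf → ℝ) (hmq : ∀ f, 0 < mq f) :
    (diracMatrix U mq).det = ((‖(diracMatrix U mq).det‖ : ℝ) : ℂ) := by
  have hre : 0 < ((diracMatrix U mq).det).re := by
    have hf : ∀ f, fermionDet (wilsonDirac (fundamentalRep (Fin 3)) U (mq f) 1) =
        (((fermionDet (wilsonDirac (fundamentalRep (Fin 3)) U (mq f) 1)).re : ℝ) : ℂ) := fun f =>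
      fermionDet_wilsonDirac_eq_ofReal_of_mass_pos _ fundamentalRep_mem_unitaryGroup U (mq f)
    rw [det_diracMatrix, Finset.prod_congr rfl fun f _ => hf f, ← Complex.ofReal_prod,
      Complex.ofReal_re]
    exact Finset.prod_pos fun f _ =>
      fermionDet_wilsonDirac_re_pos _ fundamentalRep_mem_unitaryGroup U (hmq f)
  rw [norm_det_diracMatrix_eq_abs_re, abs_of_pos hre]
  exact det_diracMatrix_eq_ofReal_re U mq

/-- Hence the sign-coherence ratio of clause (iv) is exactly `1` for all-positive bare tuples, at
every coupling and on every torus. -/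
theorem signRatio_eq_one_of_pos {S : ℕ} [NeZero S] (β : ℝ) (mq : Fin Nf → ℝ) (hmq : ∀ f, 0 < mq f) :
    ‖∫ U : GaugeConfig 4 S (Matrix.specialUnitaryGroup (Fin 3) ℂ), (diracMatrix U mq).det ∂(wilsonMeasure (fundamentalRep (Fin 3)) β)‖ /
      (∫ U : GaugeConfig 4 S (Matrix.specialUnitaryGroup (Fin 3) ℂ), ‖(diracMatrix U mq).det‖ ∂(wilsonMeasure (fundamentalRep (Fin 3)) β)) = 1 := by
  have hZ := integral_norm_det_diracMatrix_pos_all (S := S) β mq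
  have hI : ∫ U : GaugeConfig 4 S (Matrix.specialUnitaryGroup (Fin 3) ℂ), (diracMatrix U mq).det ∂(wilsonMeasure (fundamentalRep (Fin 3)) β) =
      ∫ U : GaugeConfig 4 S (Matrix.specialUnitaryGroup (Fin 3) ℂ), ((‖(diracMatrix U mq).det‖ : ℝ) : ℂ) ∂(wilsonMeasure (fundamentalRep (Fin 3)) β) :=
    integral_congr_ae (Eventually.of_forall fun U => det_diracMatrix_eq_norm_of_pos U mq hmq)
  rw [hI, integral_complex_ofReal, Complex.norm_real, Real.norm_eq_abs, abs_of_pos hZ, div_self hZ.ne']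

/-- **The crux minus (iii) holds** — witnessed by `heavyReg` with `(s, δ, C) = (1/2, δ, 1440)` for ANY
`δ > 0` in (ii) and ratio `1` in (iv).  So clauses (i), (ii), (iv) and both scalings carry no
content by themselves; (iii) is the sole honesty pin of `MobilityGap`. -/
theorem mobilityGapWithoutLower_holds : MobilityGapWithoutLower := by
  intro Nf _
  refine ⟨heavyReg Nf, heavyReg_hasMassScaling, heavyReg_hasAsymptoticScaling, fun m hm => ⟨?_, ?_, ?_⟩⟩
  · -- (i)
    intro f
    exact Eventually.of_forall fun k => by linarith [(heavyReg_bare_window m hm k f).1]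
  · -- (ii) at physical rate δ := 1 (any positive rate works)
    obtain ⟨C, μ, hC, hμ, hhop⟩ :=
      Summit.QuantumFields.QCD.Theorems.ThickCollarFarStability.stub_hopping Nf
    refine ⟨1 / 2, 1, C, by norm_num, by norm_num, one_pos, ?_⟩
    have hsmall : ∀ᶠ k in atTop, (heavyReg Nf).a k ≤ μ / 2 :=
      (heavyReg Nf).tendsto_a.eventually (eventually_le_nhds (by positivity))
    filter_upwards [hsmall] with k hk S _ f v hv
    have hb := hhop ((heavyReg Nf).β k) (bare (heavyReg Nf) m k) f (heavyReg_bare_window m hm k f).2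
      S (1 / 2) (by norm_num) (by norm_num) v hv
    refine hb.trans (mul_le_mul_of_nonneg_left (Real.exp_le_exp.2 ?_) hC)
    have hv0 : 0 ≤ ‖v‖ := norm_nonneg _
    nlinarith
  · -- (iv): ratio = 1
    refine Eventually.of_forall fun k => ?_
    rw [signRatio_eq_one_of_pos ((heavyReg Nf).β k) (bare (heavyReg Nf) m k)
      fun f => by linarith [(heavyReg_bare_window m hm k f).1]]
    norm_num

/-- ... while, by §2, the same witness violates (iii) for EVERY positive mass tuple and flavour. -/
theorem heavyReg_not_lower (hNf : 0 < Nf) (m : Fin Nf → ℝ) (hm : ∀ f, 0 < m f) :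
    ¬ Lower (heavyReg Nf) m :=
  not_lower_of_frequently_heavy (heavyReg Nf) m ⟨0, hNf⟩
    (Frequently.of_forall fun k => (heavyReg_bare_window m hm k ⟨0, hNf⟩).2)

end Summit.QuantumFields.QCD.Theorems.MobilityGapNegative

end
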